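import Summits.CriticalPhenomena.CardyFormulaZ2.Theorems.CardyFlipRussoQuadrupoleSelectionRulePoissonPerturbationAt
import Summits.CriticalPhenomena.CardyFormulaZ2.Theorems.CardyFlipRussoQuadrupoleSelectionRulePoissonLegContinuity
import Summits.CriticalPhenomena.CardyFormulaZ2.Theorems.CardyFlipRussoQuadrupoleSelectionRuleLegMVTRight

/-!
# Kernel bound ⟹ constancy of an annealed observable along a Poisson superposition leg

Helper file for the crux `QuadrupoleSelectionRule` (stmt-CriticalPhenomena-7029, informal) of route
`CardyFlipRusso` (sub-problem `CardyFormulaZ2`), line `Sketch`, generation 3 — the CONCRETE end of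
the transfer chain for the Poisson superposition legs of the route (L2 of `VoronoiHubFromSmirnov`:
superpose an independent Poisson process of intensity `t • ρ` on the rest; the Poisson component
of L3 of `SquareFromVoronoiHub` likewise).

Along such a leg the annealed observable is `t ↦ ∫ F(c ∪ c') d(P ⊗ Q_t)` (`P` the law of the
rest, `Q_t` Poisson of intensity `t • ρ`, `F` bounded measurable — e.g. the quenched crossing
probability of the Voronoi colouring of the configuration at mesh `δ`).  Three landed inputs:

* the perturbation (Margulis–Russo) formula at every `t₀ ≥ 0`
  (`hasDerivWithinAt_integral_union_poisson_at`): right derivative = the annealed INSERTION EFFECT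
  `∫ (E[F(c ∪ c' ∪ {x})] − E[F(c ∪ c')]) ρ(dx)`;
* continuity in `t` (`continuousOn_integral_union_poisson`);
* the one-sided mean-value step (`uniform_close_of_deriv_right_bound`).

`uniform_close_poissonLeg_of_kernel_bound` composes them for mesh-indexed data: if the annealed
insertion effect is bounded by `η δ` uniformly in `t ∈ [0, 1)` and `η δ → 0` as `δ → 0⁺` — the
form the kernel crux takes on an insertion leg once vertex insertion is reduced to a star
refinement (neutral: `crossing_starRefine_eq`) followed by diagonal flips — then the annealed
observable is uniformly close along the whole leg for small mesh, which is what an `ε/2`-argument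
against the anchored end of the leg consumes.
-/

noncomputable section

open MeasureTheory ProbabilityTheory Filter Set
open scoped ENNReal NNReal Topology

namespace Summit.CriticalPhenomena.CardyFormulaZ2.Theorems

open Literature.Analysis.FunctionSpaces

section PoissonLeg

variable {E : Type*} [TopologicalSpace E] [T2Space E] [SecondCountableTopology E]
  [MeasurableSpace E] [BorelSpace E]

/-- **Kernel bound ⟹ leg constancy (Poisson superposition leg).**  Mesh-indexed data: rest
laws `P δ` (finite), bounded measurable observables `F δ`, finite atomless measures `ρ δ` and the
Poisson families `Q δ t` of intensity `t • ρ δ` (`t ≥ 0`).  If the annealed insertion effect (the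
right derivative of `t ↦ ∫ F δ (c ∪ c') d(P δ ⊗ Q δ t)`) is bounded by `η δ` uniformly in
`t ∈ [0, 1)` and `η δ → 0` as `δ → 0⁺`, then for every `ε > 0` there is `δ₀ > 0` such that the
annealed observables at any two leg parameters `t, t' ∈ [0, 1]` differ by at most `ε` whenever
`0 < δ < δ₀`. [folklore] -/
theorem uniform_close_poissonLeg_of_kernel_bound
    (P : ℝ → Measure (PointConfig E)) [∀ δ, IsFiniteMeasure (P δ)]
    (ρ : ℝ → Measure E) [∀ δ, IsFiniteMeasure (ρ δ)] (hρ : ∀ δ x, ρ δ {x} = 0)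
    (Q : ℝ → ℝ → Measure (PointConfig E))
    (hQ : ∀ δ t, 0 ≤ t → IsPoissonPointProcess ((ENNReal.ofReal t) • ρ δ) (Q δ t))
    (F : ℝ → PointConfig E → ℝ) (hFm : ∀ δ, Measurable (F δ)) (M : ℝ → ℝ)
    (hFb : ∀ δ c, |F δ c| ≤ M δ) (η : ℝ → ℝ)
    (hkernel : ∀ δ, 0 < δ → δ < 1 → ∀ t ∈ Ico (0 : ℝ) 1,
      |∫ x, ((∫ p, F δ (p.1 ∪ p.2 ∪ PointConfig.ofFn ![x]) ∂((P δ).prod (Q δ t))) -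
          ∫ p, F δ (p.1 ∪ p.2) ∂((P δ).prod (Q δ t))) ∂(ρ δ)| ≤ η δ)
    (hη : Tendsto η (𝓝[>] 0) (𝓝 0)) :
    ∀ ε : ℝ, 0 < ε → ∃ δ₀ : ℝ, 0 < δ₀ ∧ ∀ δ : ℝ, 0 < δ → δ < δ₀ →
      ∀ t ∈ Icc (0 : ℝ) 1, ∀ t' ∈ Icc (0 : ℝ) 1,
        |(∫ p, F δ (p.1 ∪ p.2) ∂((P δ).prod (Q δ t))) -
          ∫ p, F δ (p.1 ∪ p.2) ∂((P δ).prod (Q δ t'))| ≤ ε := by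
  -- the annealed observable and its Russo (insertion-effect) derivative as functions of `(t, δ)`
  set Pf : ℝ → ℝ → ℝ := fun t δ => ∫ p, F δ (p.1 ∪ p.2) ∂((P δ).prod (Q δ t)) with hPf
  set Dr : ℝ → ℝ → ℝ := fun t δ =>
    ∫ x, ((∫ p, F δ (p.1 ∪ p.2 ∪ PointConfig.ofFn ![x]) ∂((P δ).prod (Q δ t))) -
      ∫ p, F δ (p.1 ∪ p.2) ∂((P δ).prod (Q δ t))) ∂(ρ δ) with hDr
  have hcont : ∀ δ, 0 < δ → δ < 1 → ContinuousOn (fun s => Pf s δ) (Icc (0 : ℝ) 1) :=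
    fun δ _ _ => continuousOn_integral_union_poisson (P δ) (ρ δ) (Q δ) (hQ δ) (F δ) (hFm δ)
      (M δ) (hFb δ)
  have hderiv : ∀ δ, 0 < δ → δ < 1 → ∀ σ ∈ Ico (0 : ℝ) 1,
      HasDerivWithinAt (fun s => Pf s δ) (Dr σ δ) (Ici σ) σ :=
    fun δ _ _ σ hσ => hasDerivWithinAt_integral_union_poisson_at (P δ) (ρ δ) (hρ δ) (Q δ)
      (hQ δ) (F δ) (hFm δ) (M δ) (hFb δ) σ hσ.1
  exact uniform_close_of_deriv_right_bound Pf Dr η 1 one_pos hcont hderiv hkernel hη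

end PoissonLeg

end Summit.CriticalPhenomena.CardyFormulaZ2.Theorems

end
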